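import Summits.BirchSwinnertonDyer.BirchSwinnertonDyer.Theorems.GenusKolyvaginAtTwoK4NegOrdinaryWitnessDiscriminant
import HarnessLib

/-!
# Route `GenusKolyvaginAtTwo`, K₄⁻ kernel `K4Neg` (stmt-BirchSwinnertonDyer-31526), LINE 34 «twin_bsd_road⁻» v1.5 (F4ᵖᵍ census):
# THE DISCRIMINANT DICTIONARY, MODEL-FREE — `E[2]` is unramified at the good ordinary place over `2` as soon as `√Δ` is, e.g. `Δ_W ∈ ℚ^{×2}·(1 + 4ℤ)`

Width seat `bsd-line-gk2-p5` g42 (cell `bsd-f1-sign2`), WIDTH-5 attach on route `GenusKolyvaginAtTwo` rev 59, lane `(NPh_K)` off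
the cut.  `--supports stmt-BirchSwinnertonDyer-31526 --as helper`.  THEOREMS ONLY (no definition, no named fact, no `sorry`); standard
axioms.  **BSD is NOT proved by this file; `K4Neg` is NOT proved; no item is closed by it.**

WHAT.  The companion `…K4NegOrdinaryWitnessDiscriminant` proved the dictionary «good ordinary at `v ∋ 2` and `Δ_W = 1 + 4m` ⟹ `E[2]`
unramified at `v`» for the GIVEN model `W`.  The conclusion only depends on the Galois set `E[2] ∖ O`, and the discriminant input only
through the quadratic field `ℚ(√Δ)`, i.e. through `Δ_W` modulo `ℚ^{×2}` (a change of model multiplies `Δ` by `u¹²`).  This file states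
the dictionary in that MODEL-FREE form, in two layers:
* §1 ★ `absGaloisRestrict_smul_eq_of_mul_self_eq_of_mem_absInertia` — the reusable core of the companion's §2: for `u ∈ ℚ̄` with
  `u² = 1 + 4m` (`m ∈ ℤ`) and any place `v` with `‖2‖_v < 1`, every `τ ∈ I_{ℚ_v}` has `res τ · u = u` («`ℚ_v(√(1+4m))/ℚ_v` is unramified»:
  the Artin–Schreier root `(1 + u)/2`, companion §1, transported along `absClosureEmbedding`).
  ★′ `absGaloisRestrict_smul_delta_eq_of_mem_absInertia_of_sq_mul` — hence `res τ · δ = δ` whenever `Δ_W = r²(1 + 4m)`, `r ∈ ℚ^×`.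
* §2 ★★ `torsionFixing_two_of_mem_absInertia_of_smul_delta_eq` — **THE DICTIONARY, MODEL-FREE**: `v ∋ 2` good ORDINARY, `τ ∈ I_{ℚ_v}` with
  `res τ · δ = δ` (i.e. `res τ` trivial on `√Δ`) ⟹ `res τ ∈ Γ_{ℚ(E[2])}` (same proof as the companion's §3: even permutation of the three
  letters fixing the kernel-of-reduction letter).  ★★′ `torsionFixing_two_of_mem_absInertia_of_Δ_eq_sq_mul`: with `Δ_W = r²(1 + 4m)`.
* §3 ★★★ `not_mem_selmerLocalKer_two_of_Δ_eq_sq_mul`, ★★★′ `offCutNonPhantomAtTwo_of_Δ_eq_sq_mul` — the ordinary witness and `(NPh_K)` at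
  every `2`-split admissible frame from «`ρ̄_{W,2}`, `ρ_{W,4}` (resp. the `2`-adic tower) onto, `v ∋ 2` good ordinary, `Δ_W = r²(1 + 4m)`»;
  for a non-minimal model of a curve with `Δ_min ≡ 1 (mod 4)` take `r = u⁶`.
Nothing is closed; BSD is NOT proved by any of this.

References: [DokchitserDokchitserMathZ2012] Theorem (1), proof; [NeukirchANT1999] Ch. II (9.3); [SerreInventiones1972] §1.11;
[SilvermanAEC2009] VII.2.1, VIII.§1; [LawsonWuthrich2016] §3, §7.1.
-/

set_option linter.dupNamespace false -- `Summit.<P>.<Sub>` repeats `BirchSwinnertonDyer` (D-0017)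
set_option autoImplicit false

noncomputable section

open scoped Classical NNReal NumberField

namespace Summit.BirchSwinnertonDyer.BirchSwinnertonDyer.Theorems.GenusExact.Lw2PhantomExclusion.OrdinaryWitness

open WeierstrassCurve Field NumberField IsDedekindDomain
open Literature.NumberTheory.GaloisRepresentations Literature.NumberTheory.EllipticCurves
open Literature.NumberTheory.GaloisRepresentations.IsNonarchimedeanLocalField
open Literature.NumberTheory IsDedekindDomain.HeightOneSpectrum
open Literature.NumberTheory.EllipticCurves.DokchitserDokchitser2012

/-! ## §1 ★ `√(1 + 4m)` is fixed by inertia at a place with `‖2‖ < 1` -/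

section Core

/-- ★ **`ℚ_v(√(1 + 4m))/ℚ_v` is unramified** (`‖2‖_v < 1`): for `u ∈ ℚ̄` with `u·u = 1 + 4m` (`m ∈ ℤ`) and `τ ∈ I_{ℚ_v}`, the restriction
`res τ ∈ Γ_ℚ` (tree `absGaloisRestrict`, along the chosen embedding `ι : ℚ̄ → ℚ̄_v`) fixes `u`: `b = (1 + ι u)/2` satisfies `b² = b + m`, so
`τ b = b` by the Artin–Schreier lemma of the companion file (`smul_eq_self_of_mem_absInertia_of_mul_self_eq_add`), hence `τ (ι u) = ι u`,
i.e. `ι (res τ · u) = ι u` (`absGaloisRestrict_apply_smul`) and `res τ · u = u`. [cite: NeukirchANT1999, Ch. II (9.3) Definition (inertia group)] -/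
theorem absGaloisRestrict_smul_eq_of_mul_self_eq_of_mem_absInertia
    (v : HeightOneSpectrum (𝓞 ℚ)) (h2v : algNorm (v.adicCompletion ℚ) 2 < 1)
    {m : ℤ} {u : AlgebraicClosure ℚ} (hu : u * u = 1 + 4 * (m : AlgebraicClosure ℚ))
    {τ : absoluteGaloisGroup (v.adicCompletion ℚ)} (hτ : τ ∈ absInertia (v.adicCompletion ℚ)) :
    absGaloisRestrict ℚ (v.adicCompletion ℚ) τ • u = u := by
  -- `2 ≠ 0` in `ℚ̄_v` (no `CharZero` instance is put on `ℚ_v`: that would change the `ℚ`-algebra structure found by inference)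
  have h2F : (2 : AlgebraicClosure (v.adicCompletion ℚ)) ≠ 0 := by
    intro h0
    apply two_ne_zero (α := ℚ)
    apply (algebraMap ℚ (AlgebraicClosure (v.adicCompletion ℚ))).injective
    rw [map_ofNat, h0, map_zero]
  -- transport along `ι : ℚ̄ → ℚ̄_v`
  have hU : absClosureEmbedding ℚ (v.adicCompletion ℚ) u * absClosureEmbedding ℚ (v.adicCompletion ℚ) u =
      1 + 4 * (m : AlgebraicClosure (v.adicCompletion ℚ)) := by
    have h := congrArg (absClosureEmbedding ℚ (v.adicCompletion ℚ)) hu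
    simpa only [map_mul, map_add, map_one, map_ofNat, map_intCast] using h
  -- the Artin–Schreier root `b = (1 + ι u)/2`, `b² = b + m`
  have hb : (1 + absClosureEmbedding ℚ (v.adicCompletion ℚ) u) / 2 * ((1 + absClosureEmbedding ℚ (v.adicCompletion ℚ) u) / 2) =
      (1 + absClosureEmbedding ℚ (v.adicCompletion ℚ) u) / 2 + (m : AlgebraicClosure (v.adicCompletion ℚ)) := by
    field_simp
    linear_combination hU
  have hτm : τ • ((m : ℤ) : AlgebraicClosure (v.adicCompletion ℚ)) = m := by
    have h := (show AlgebraicClosure (v.adicCompletion ℚ) ≃ₐ[v.adicCompletion ℚ] AlgebraicClosure (v.adicCompletion ℚ)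
      from τ).commutes (m : v.adicCompletion ℚ)
    rwa [map_intCast] at h
  have hτb := smul_eq_self_of_mem_absInertia_of_mul_self_eq_add hτ h2v (algNorm_intCast_le_one m) hτm hb
  -- so `τ` fixes `ι u = 2b - 1`
  have hτ1 : τ • (1 : AlgebraicClosure (v.adicCompletion ℚ)) = 1 := smul_one τ
  have hτU : τ • absClosureEmbedding ℚ (v.adicCompletion ℚ) u = absClosureEmbedding ℚ (v.adicCompletion ℚ) u := by
    have hUb : absClosureEmbedding ℚ (v.adicCompletion ℚ) u =
        (1 + absClosureEmbedding ℚ (v.adicCompletion ℚ) u) / 2 + (1 + absClosureEmbedding ℚ (v.adicCompletion ℚ) u) / 2 - 1 := by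
      field_simp
      ring
    rw [hUb, smul_sub, smul_add, hτb, hτ1]
  -- transport back: `ι (res τ • u) = τ • ι u = ι u`
  apply (absClosureEmbedding ℚ (v.adicCompletion ℚ)).toRingHom.injective
  change absClosureEmbedding ℚ (v.adicCompletion ℚ) _ = absClosureEmbedding ℚ (v.adicCompletion ℚ) _
  rw [absGaloisRestrict_apply_smul]
  exact hτU

variable (W : WeierstrassCurve ℚ) [W.IsElliptic]

/-- ★′ **`Δ_W = r²(1 + 4m)` ⟹ inertia fixes `δ`** (`r ∈ ℚ^×`, `m ∈ ℤ`, `‖2‖_v < 1`, `τ ∈ I_{ℚ_v}`): `u = 4δ/r` has `u² = Δ_W/r² = 1 + 4m`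
(`Δ = 16δ²`, tree `algebraMap_Δ`), so `res τ` fixes `u` (★) and hence `δ`.  The model-free form of the companion's §2 (`r = 1`).
[cite: DokchitserDokchitserMathZ2012, Theorem (1), proof (ℚ(E[2]) ⊃ ℚ(√Δ))] [cite: NeukirchANT1999, Ch. II (9.3)] -/
theorem absGaloisRestrict_smul_delta_eq_of_mem_absInertia_of_sq_mul (h2 : (2 : ℚ) ≠ 0)
    (v : HeightOneSpectrum (𝓞 ℚ)) (h2v : algNorm (v.adicCompletion ℚ) 2 < 1)
    {r : ℚ} (hr : r ≠ 0) {m : ℤ} (hΔ : W.Δ = r ^ 2 * (1 + 4 * m))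
    {τ : absoluteGaloisGroup (v.adicCompletion ℚ)} (hτ : τ ∈ absInertia (v.adicCompletion ℚ)) :
    absGaloisRestrict ℚ (v.adicCompletion ℚ) τ • delta W h2 = delta W h2 := by
  -- every `algebraMap ℚ ℚ̄ q` is written as the cast `(q : ℚ̄)` (`eq_ratCast`), so that no `ℚ`-algebra instance on `ℚ̄` is compared
  -- `u = (4/r) δ` has `u² = 1 + 4m`
  have hc : ((4 / r : ℚ) : AlgebraicClosure ℚ) ≠ 0 := by
    rw [Ne, Rat.cast_eq_zero]
    exact div_ne_zero four_ne_zero hr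
  have h16 : (16 : AlgebraicClosure ℚ) * delta W h2 ^ 2 =
      ((r ^ 2 : ℚ) : AlgebraicClosure ℚ) * (((1 + 4 * m : ℚ)) : AlgebraicClosure ℚ) := by
    have h := algebraMap_Δ W h2
    rw [eq_ratCast, hΔ, Rat.cast_mul] at h
    exact h.symm
  have hrr : ((4 / r : ℚ) : AlgebraicClosure ℚ) * ((4 / r : ℚ) : AlgebraicClosure ℚ) * ((r ^ 2 : ℚ) : AlgebraicClosure ℚ) = 16 := by
    rw [← Rat.cast_mul, ← Rat.cast_mul, show (4 / r * (4 / r) * r ^ 2 : ℚ) = 16 by field_simp; ring, Rat.cast_ofNat]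
  have hm : (((1 + 4 * m : ℚ)) : AlgebraicClosure ℚ) = 1 + 4 * (m : AlgebraicClosure ℚ) := by
    push_cast
    ring
  have hu : (((4 / r : ℚ) : AlgebraicClosure ℚ) * delta W h2) * (((4 / r : ℚ) : AlgebraicClosure ℚ) * delta W h2) =
      1 + 4 * (m : AlgebraicClosure ℚ) := by
    rw [← hm]
    linear_combination (((4 / r : ℚ) : AlgebraicClosure ℚ) * ((4 / r : ℚ) : AlgebraicClosure ℚ)) * h16 / 16
      + (((1 + 4 * m : ℚ)) : AlgebraicClosure ℚ) * hrr / 16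
  have hfix := absGaloisRestrict_smul_eq_of_mul_self_eq_of_mem_absInertia v h2v hu hτ
  -- `res τ` fixes the rational scalar `4/r`; cancel it
  have hcfix : absGaloisRestrict ℚ (v.adicCompletion ℚ) τ • ((4 / r : ℚ) : AlgebraicClosure ℚ) =
      ((4 / r : ℚ) : AlgebraicClosure ℚ) := by
    have h := (show AlgebraicClosure ℚ ≃ₐ[ℚ] AlgebraicClosure ℚ from absGaloisRestrict ℚ (v.adicCompletion ℚ) τ).commutes (4 / r)
    rwa [eq_ratCast] at h
  rw [smul_mul', hcfix] at hfix
  exact mul_left_cancel₀ hc hfix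

end Core

/-! ## §2 ★★ The dictionary, model-free: inertia trivial on `√Δ` ⟹ inertia trivial on `E[2]` (good ordinary at `v ∋ 2`) -/

section Dictionary

variable (W : WeierstrassCurve ℚ) [W.IsElliptic]

/-- ★★ **THE DICTIONARY, MODEL-FREE.**  `W/ℚ` elliptic, `v` the place over `2`, of GOOD ORDINARY reduction, `τ ∈ I_{ℚ_v}` whose restriction
fixes the letter-discriminant `δ` (`Δ = 16δ²`; i.e. `res τ` is trivial on `ℚ(√Δ)`).  Then `res τ ∈ Γ_{ℚ(E[2])}`: `res τ` permutes the letters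
`T₀, T₁, T₂` EVENLY (`σδ = sign(σ)δ`, Dokchitser–Dokchitser, tree `smul_delta`) and FIXES the letter spanning the kernel-of-reduction line
(`goodReduction_reduction_line`: inertia does not move reductions, `#(ker ∩ E[2]) = 2` for ordinary reduction); an even permutation of three
letters with a fixed letter is the identity (companion §0).  The companion's §3 is the case «`res τ · δ = δ` because `Δ_W = 1 + 4m`».
[cite: DokchitserDokchitserMathZ2012, Theorem (1), proof (ℚ(E[2]) ⊃ ℚ(√Δ))] [cite: SerreInventiones1972, §1.11 Prop. 11 and Cor.]
[cite: SilvermanAEC2009, VII.2.1, VIII.§1] -/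
theorem torsionFixing_two_of_mem_absInertia_of_smul_delta_eq (h2 : (2 : ℚ) ≠ 0)
    (v : HeightOneSpectrum (𝓞 ℚ)) (hv2 : ((2 : ℕ) : 𝓞 ℚ) ∈ v.asIdeal) (hgood : W.HasGoodReductionAt v)
    (hord : ¬ (((2 : ℕ) : ℤ) ∣ W.frobeniusTraceAt v))
    {τ : absoluteGaloisGroup (v.adicCompletion ℚ)} (hτ : τ ∈ absInertia (v.adicCompletion ℚ))
    (hδ : absGaloisRestrict ℚ (v.adicCompletion ℚ) τ • delta W h2 = delta W h2) :
    absGaloisRestrict ℚ (v.adicCompletion ℚ) τ ∈ torsionFixing W (2 : ℤ) := by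
  haveI : Fact (Nat.Prime 2) := ⟨Nat.prime_two⟩
  -- the local good-reduction frame and the reduction map on `E(ℚ̄)`
  obtain ⟨w, hw, φ, Φ₀, hX, _, hΔO, hΦ₀⟩ := exists_goodReduction_localModel W v hgood
  set f : geomPoints W →+ (((W.localMinimalIntegralModel v).map φ).map
      (IsLocalRing.residue w.valuationSubring)).toAffine.Point :=
    (goodReductionHom ((W.localMinimalIntegralModel v).map φ)
      (Valuation.valuationSubring.integers w) hΔO).comp
      (((Φ₀.trans (Affine.Point.congrEquiv hX)).toAddMonoidHom).comp
        (pointsMap W (v.adicCompletion ℚ))) with hfdef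
  have hf : ∀ a, f a = goodReductionHom ((W.localMinimalIntegralModel v).map φ)
      (Valuation.valuationSubring.integers w) hΔO
      (Affine.Point.congrEquiv hX (Φ₀ (pointsMap W (v.adicCompletion ℚ) a))) := fun a ↦ rfl
  obtain ⟨-, hinv, hcard⟩ := goodReduction_reduction_line W 2 v hv2 hgood hord hw hΔO hX Φ₀ hΦ₀ f hf
  set σ := absGaloisRestrict ℚ (v.adicCompletion ℚ) τ with hσdef
  -- ### the kernel-of-reduction LINE `Λ = ker f ∩ E[2] = {0, T₀}`
  have hcard2 : Nat.card ↥(f.ker ⊓ geomTorsion W (2 : ℤ)) = 2 := hcard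
  obtain ⟨u₁, u₂, hne, huniv⟩ := Nat.card_eq_two_iff.mp hcard2
  have hmemΛ : ∀ S : geomTorsion W (2 : ℤ), (S : geomPoints W) ∈ f.ker →
      ∃ u : ↥(f.ker ⊓ geomTorsion W (2 : ℤ)), (u : geomPoints W) = S := fun S hS ↦
    ⟨⟨S, AddSubgroup.mem_inf.mpr ⟨hS, S.2⟩⟩, rfl⟩
  have htwo : ∀ u : ↥(f.ker ⊓ geomTorsion W (2 : ℤ)), u = u₁ ∨ u = u₂ := fun u ↦ by
    have hu : u ∈ ({u₁, u₂} : Set _) := by rw [huniv]; exact Set.mem_univ u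
    simpa using hu
  obtain ⟨T₀', hT₀'ne, hT₀'all⟩ : ∃ T : ↥(f.ker ⊓ geomTorsion W (2 : ℤ)), T ≠ 0 ∧
      ∀ u : ↥(f.ker ⊓ geomTorsion W (2 : ℤ)), u = 0 ∨ u = T := by
    by_cases h1 : u₁ = 0
    · refine ⟨u₂, fun h ↦ hne (h1.trans h.symm), fun u ↦ ?_⟩
      rcases htwo u with h | h
      · exact Or.inl (h.trans h1)
      · exact Or.inr h
    · refine ⟨u₁, h1, fun u ↦ ?_⟩
      rcases htwo u with h | h
      · exact Or.inr h
      · rcases htwo 0 with h0 | h0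
        · exact absurd h0.symm h1
        · exact Or.inl (h.trans h0.symm)
  let T₀ : geomTorsion W (2 : ℤ) := ⟨(T₀' : geomPoints W), (AddSubgroup.mem_inf.mp T₀'.2).2⟩
  have hT₀ : T₀ ≠ 0 := by
    intro h
    apply hT₀'ne
    apply Subtype.ext
    have h' : ((T₀ : geomTorsion W (2 : ℤ)) : geomPoints W) = ((0 : geomTorsion W (2 : ℤ)) : geomPoints W) :=
      congrArg Subtype.val h
    exact h'
  have hline : ∀ S : geomTorsion W (2 : ℤ), (S : geomPoints W) ∈ f.ker → S = 0 ∨ S = T₀ := by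
    intro S hS
    obtain ⟨u, hu⟩ := hmemΛ S hS
    rcases hT₀'all u with h | h
    · left
      exact Subtype.ext (by rw [← hu, h]; rfl)
    · right
      exact Subtype.ext (by rw [← hu, h])
  -- ### inertia FIXES `T₀`: `σ T₀ ∈ Λ ∖ 0`
  have hσT₀ : σ • T₀ = T₀ := by
    have hmem : ((σ • T₀ : geomTorsion W (2 : ℤ)) : geomPoints W) ∈ f.ker := by
      rw [AddMonoidHom.mem_ker, AddSubgroup.torsionBy.coe_smul, hσdef, hinv τ hτ]
      exact (AddMonoidHom.mem_ker).mp (AddSubgroup.mem_inf.mp T₀'.2).1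
    rcases hline (σ • T₀) hmem with h0 | h0
    · exfalso
      apply hT₀
      rw [← rho_apply W σ T₀] at h0
      exact (rho W σ).map_eq_zero_iff.mp h0
    · exact h0
  -- ### so `permGal σ` fixes the letter of `T₀` …
  obtain ⟨i₀, hi₀⟩ : ∃ i, T₀ = T W h2 i := (eq_zero_or_eq_T W h2 T₀).resolve_left hT₀
  have hfix : permGal W h2 σ i₀ = i₀ := T_injective W h2 (by rw [T_permGal, ← hi₀, hσT₀])
  -- ### … and is EVEN: `σ δ = δ`
  have hsign : Equiv.Perm.sign (permGal W h2 σ) = 1 := by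
    rcases Int.units_eq_one_or (Equiv.Perm.sign (permGal W h2 σ)) with h | h
    · exact h
    · exfalso
      have hsd := smul_delta W h2 σ
      rw [h, hδ] at hsd
      simp only [Units.val_neg, Units.val_one, Int.cast_neg, Int.cast_one, neg_mul, one_mul] at hsd
      have h2' : (2 : AlgebraicClosure ℚ) ≠ 0 := two_ne_zero
      have htwo : (2 : AlgebraicClosure ℚ) * delta W h2 = 0 := by linear_combination hsd
      exact delta_ne_zero W h2 ((mul_eq_zero.mp htwo).resolve_left h2')
  -- ### an even permutation of three letters with a fixed letter is trivial
  have hperm : permGal W h2 σ = 1 := perm_three_eq_one_of_sign_eq_one_of_apply_eq _ hsign i₀ hfix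
  rw [mem_torsionFixing_iff]
  intro P
  rcases eq_zero_or_eq_T W h2 P with hP | ⟨i, hP⟩
  · rw [hP, ← rho_apply W σ 0, map_zero]
  · rw [hP, ← T_permGal, hperm, Equiv.Perm.one_apply]

/-- ★★′ **THE DICTIONARY FOR `Δ_W ∈ ℚ^{×2}·(1 + 4ℤ)`.**  `W/ℚ` elliptic (any model) with `Δ_W = r²(1 + 4m)`, `r ∈ ℚ^×`, `m ∈ ℤ`; `v ∋ 2` of
good ORDINARY reduction.  Then `E[2]` is unramified at `v`: `∀ τ ∈ I_{ℚ_v}, res τ ∈ Γ_{ℚ(E[2])}` (★′ and ★★; `‖2‖_v < 1` from `2 ∈ v`).  For a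
non-minimal model of a curve with `Δ_min ≡ 1 (mod 4)` take `r = u⁶`. [cite: DokchitserDokchitserMathZ2012, Theorem (1), proof]
[cite: SerreInventiones1972, §1.11 Prop. 11 and Cor.] -/
theorem torsionFixing_two_of_mem_absInertia_of_Δ_eq_sq_mul
    (v : HeightOneSpectrum (𝓞 ℚ)) (hv2 : ((2 : ℕ) : 𝓞 ℚ) ∈ v.asIdeal) (hgood : W.HasGoodReductionAt v)
    (hord : ¬ (((2 : ℕ) : ℤ) ∣ W.frobeniusTraceAt v)) {r : ℚ} (hr : r ≠ 0) {m : ℤ} (hΔ : W.Δ = r ^ 2 * (1 + 4 * m)) :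
    ∀ τ ∈ absInertia (v.adicCompletion ℚ), absGaloisRestrict ℚ (v.adicCompletion ℚ) τ ∈ torsionFixing W (2 : ℤ) := by
  intro τ hτ
  haveI : Fact (Nat.Prime 2) := ⟨Nat.prime_two⟩
  -- `‖2‖_v < 1` (through a spectral valuation of `ℚ̄_v`, which the good-reduction frame provides)
  obtain ⟨w, hw, -⟩ := exists_goodReduction_localModel W v hgood
  have h2v : algNorm (v.adicCompletion ℚ) 2 < 1 := by
    have h := spectralValuation_algebraMap_ringOfIntegers_lt_one (v := v) hw hv2
    rw [map_natCast, Nat.cast_ofNat] at h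
    exact (spectralValuation_lt_one_iff_algNorm_lt_one hw _).mp h
  exact torsionFixing_two_of_mem_absInertia_of_smul_delta_eq W two_ne_zero v hv2 hgood hord hτ
    (absGaloisRestrict_smul_delta_eq_of_mem_absInertia_of_sq_mul W two_ne_zero v h2v hr hΔ hτ)

end Dictionary

/-! ## §3 ★★★ The ordinary witness and `(NPh_K)` from `Δ_W ∈ ℚ^{×2}·(1 + 4ℤ)` -/

section Witness

variable (W : WeierstrassCurve ℚ) [W.IsElliptic]

/-- ★★★ **THE ORDINARY WITNESS FROM `Δ_W = r²(1 + 4m)`.**  `ρ̄_{W,2}`, `ρ_{W,4}` onto, `v ∋ 2` good ordinary, `Δ_W = r²(1 + 4m)` ⟹ the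
Lawson–Wuthrich class is NOT a Kummer class at `v` (companion ★★★★ with the model-free dictionary ★★′).
[cite: LawsonWuthrich2016, §3, §7.1] [cite: SerreInventiones1972, §1.11 Prop. 11 and Cor.] -/
theorem not_mem_selmerLocalKer_two_of_Δ_eq_sq_mul
    (hsurj : W.HasSurjectiveModNGaloisRep 2) (hsurj4 : W.HasSurjectiveModNGaloisRep 4)
    (v : HeightOneSpectrum (𝓞 ℚ)) (hv2 : ((2 : ℕ) : 𝓞 ℚ) ∈ v.asIdeal) (hgood : W.HasGoodReductionAt v)
    (hord : ¬ (((2 : ℕ) : ℤ) ∣ W.frobeniusTraceAt v)) {r : ℚ} (hr : r ≠ 0) {m : ℤ} (hΔ : W.Δ = r ^ 2 * (1 + 4 * m))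
    {x : galH1Torsion W (2 : ℤ)} (hx0 : x ≠ 0) (hx : ∀ h ∈ torsionFixing W (4 : ℤ), h1Eval W (2 : ℤ) x h = 0) :
    x ∉ selmerLocalKer W (v.adicCompletion ℚ) (2 : ℤ) :=
  not_mem_selmerLocalKer_two_of_unramified_twoTorsion W hsurj hsurj4 v hv2 hgood hord
    (torsionFixing_two_of_mem_absInertia_of_Δ_eq_sq_mul W v hv2 hgood hord hr hΔ) hx0 hx

/-- ★★★′ **`(NPh_K)` FROM `Δ_W = r²(1 + 4m)` AT A GOOD ORDINARY `2`** (F4″-shaped, LINE 34 v1.5 lane `(NPh_K)`): the `2`-adic tower onto,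
`v ∋ 2` good ordinary, `Δ_W = r²(1 + 4m)`, `(K, 1)` any admissible frame with `2` split ⟹ every class of `H¹(K, E[2^L])` (`L ≥ 1`) dying on
`Γ_{K(E[2^L])}` and locally Kummer above `2` vanishes.  **BSD is not proved by this; `K4Neg` is not proved; nothing is closed.**
[cite: LawsonWuthrich2016, §3, §7.1] [cite: GrossLMS1991, §9 Prop. 9.1] -/
theorem offCutNonPhantomAtTwo_of_Δ_eq_sq_mul
    (hρ : ∀ n : ℕ, 0 < n → W.HasSurjectiveModNGaloisRep ((2 : ℤ) ^ n))
    (v : HeightOneSpectrum (𝓞 ℚ)) (hv2 : ((2 : ℕ) : 𝓞 ℚ) ∈ v.asIdeal) (hgood : W.HasGoodReductionAt v)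
    (hord : ¬ (((2 : ℕ) : ℤ) ∣ W.frobeniusTraceAt v)) {r : ℚ} (hr : r ≠ 0) {m : ℤ} (hΔ : W.Δ = r ^ 2 * (1 + 4 * m))
    {K : Type} [Field K] [NumberField K] (hK : IsImaginaryQuadratic K) (hodd : Odd (NumberField.discr K))
    (hnsq₁ : ¬ IsSquare ((NumberField.discr K : ℚ) * -|W.Δ|))
    (hnsq₂ : ¬ IsSquare ((NumberField.discr K : ℚ) * (-(2 * |W.Δ|))))
    (h2K : ((Ideal.span {(2 : ℤ)}).primesOver (𝓞 K)).ncard = 2) :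
    ∀ (L : ℕ), 1 ≤ L → ∀ z : galH1Torsion (W.baseChange K) ((2 ^ L : ℕ) : ℤ),
      (∀ ρ' ∈ torsionFixing (W.baseChange K) ((2 ^ L : ℕ) : ℤ), h1Eval (W.baseChange K) ((2 ^ L : ℕ) : ℤ) z ρ' = 0) →
      (∀ w : HeightOneSpectrum (𝓞 K), ((2 : ℕ) : 𝓞 K) ∈ w.asIdeal →
        z ∈ selmerLocalKer (W.baseChange K) (w.adicCompletion K) ((2 ^ L : ℕ) : ℤ)) → z = 0 :=
  offCutNonPhantomAtTwo_of_unramified_twoTorsion W hρ v hv2 hgood hord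
    (torsionFixing_two_of_mem_absInertia_of_Δ_eq_sq_mul W v hv2 hgood hord hr hΔ) hK hodd hnsq₁ hnsq₂ h2K

end Witness

end Summit.BirchSwinnertonDyer.BirchSwinnertonDyer.Theorems.GenusExact.Lw2PhantomExclusion.OrdinaryWitness

end
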